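import Literature.Analysis.FluidPDE.EulerReynolds
import Summits.AnomalousDissipation.AnomalousDissipation.Theorems.MarginalStabilityChainChainRealisationStubLoudOfContrast
import Literature.Analysis.FluidPDE.LongTimeAveragePeriodic
import Literature.Analysis.FluidPDE.LongTimeAverageSubadditive
import Literature.Analysis.FluidPDE.TimeAverageMeasureBasic
import Literature.Analysis.FluidPDE.ZerothLawProofs
import Literature.Analysis.FunctionSpaces.TorusClassicalNSGluing

/-!
# Crux `BoussinesqLadder` (stmt-AnomalousDissipation-1449, route `BoussinesqOctaves`) — the TOWER SPLIT
# (crux-strategist, BC2 redirect of the RESTATED deciding crux; FRAME FORM — importable by the route module)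

`BoussinesqLadder` (= the CoherentStates witness class on every rung of a geometric viscosity ladder) is
at least as strong as the summit. This file cuts it along the route's OWN seam — the one its header
announces ("OctaveTower … the stress-realisation half; terminal exact solve … deliberately NOT filed") —
into two typed pieces, neither of which produces the summit's witnesses by itself:

* `K41Tower` (∃, the SUBSOLUTION half): one smooth steady force `f` and, on every rung `ν_n = ν₀σⁿ`,
  a time-periodic classical FORCED-NS-REYNOLDS SUBSOLUTION `(U_n, P_n, R_n)` — Navier–Stokes at
  viscosity `ν_n` with force `f + div R_n`, residual stress `|R_n| ≤ B√ν_n` — in the K41 class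
  (mean-zero, Kolmogorov gradient cap `|∂ᵢU_n| ≤ A/√ν_n`), with ν-uniform mean energy `≤ E` and a
  ν-uniform INJECTION FLOOR `⟨∫⟪f, U_n⟫⟩ ≥ ε > 0`. (= crux `OctaveTower` rung by rung, its increment
  clause replaced by the energy bound it implies.) Subsolutions are not solutions: no summit witness.
* `TowerClosing` (∀∃, the CLOSING LAW over exactly that class): every such tower is eventually
  SHADOWED by exact coherent states — for `n ≥ N`, an exact time-periodic classical solution `u_n` of
  NS_{ν_n} forced by `f` alone, within ONE DISSIPATION-RANGE OCTAVE of the tower in mean energy,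
  `⟨‖u_n − U_n‖₂²⟩ ≤ D√ν_n`, absorbing a fixed fraction of the injected power, `⟨∫⟪f, u_n⟫⟩ ≥ θε`.
  A law about towers: without a tower it asserts nothing (no summit witness either).

The ASSEMBLY `boussinesqLadder_of_pieces : K41Tower → TowerClosing → BoussinesqLadder` is proved below
and is not bookkeeping: (i) the ladder is re-based at rung `N` (`ν₀' = ν₀σᴺ`, still geometric);
(ii) the ENERGY bound of the exact states is transferred from the tower through the shadowing distance
(`⟨‖u‖²⟩ ≤ 2⟨‖U‖²⟩ + 2⟨‖u − U‖²⟩` for the `limsup` long-time means of smooth periodic fields with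
INCOMMENSURABLE periods — pointwise parallelogram bound, local integrability and bounded running means,
`longTimeAvgSup_le_add_of_le_add`); (iii) the DISSIPATION floor is the power floor through the
period-averaged ENERGY IDENTITY `⟨ν‖∇u‖₂²⟩ = ⟨∫⟪f,u⟫⟩` for time-periodic classical solutions
(`Torus.IsClassicalNSSolutionOn.energy_eq` via `meanDissipation_eq_longTimeAvgSup_inner`, the spectral
dissipation of `meanDissipation` identified with the classical one on smooth slices).

References: Buckmaster–Vicol, EMS Surv. 6 (2019/2020) Rem. 6.4 (β = 1/3 endpoint of truncated convex
integration with residual force) and §8; Doering–Foias, JFM 467 (2002) §2; Robinson–Rodrigo–Sadowski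
(CUP 2016) Thm. 6.5; van den Berg–Breden–Lessard–van Veen, J. Nonlinear Sci. 31 (2021) (rigorous
periodic orbits of Navier–Stokes by Newton–Kantorovich); Cheskidov, arXiv:2311.04182 §6.
-/

set_option linter.dupNamespace false

noncomputable section

open MeasureTheory Set Filter Topology Function
open scoped InnerProductSpace
open Literature.Analysis.FunctionSpaces Literature.Analysis.FunctionSpaces.Torus
open Literature.Analysis.FluidPDE

namespace Summit.AnomalousDissipation.AnomalousDissipation.Cruxes.BoussinesqLadder.TowerSplit

/-! ## The two pieces (children of the split; statements = `children.json` verbatim) -/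

/-- **Child 1 — `K41Tower` (crux, ∃; the subsolution half).** One smooth steady divergence-free
mean-zero force `f`, a geometric ladder `ν_n = ν₀σⁿ` and, on EVERY rung, a `τ_n`-periodic classical
forced-NS-Reynolds subsolution `(U_n, P_n, R_n)` (Navier–Stokes at viscosity `ν_n` with force
`f + div R_n`, `R_n` jointly smooth, symmetric, `τ_n`-periodic) in the K41 class — mean-zero velocities,
Kolmogorov gradient cap `‖∂ᵢU_n‖ ≤ A/√ν_n`, residual stress `‖R_n eⱼ‖ ≤ B√ν_n` — with ν-UNIFORM mean
energy `⟨‖U_n‖₂²⟩ ≤ E` and injection floor `⟨∫⟪f, U_n⟫⟩ ≥ ε > 0`. -/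
def K41Tower : Prop :=
  ∃ f : UnitAddTorus (Fin 3) → EuclideanSpace ℝ (Fin 3), Literature.Analysis.FunctionSpaces.Torus.IsSmooth f ∧ Literature.Analysis.FunctionSpaces.Torus.IsDivFree f ∧ Literature.Analysis.FunctionSpaces.Torus.HasZeroMean f ∧ ∃ (ν₀ σ A B E ε : ℝ) (τ : ℕ → ℝ) (U : ℕ → ℝ → UnitAddTorus (Fin 3) → EuclideanSpace ℝ (Fin 3)) (P : ℕ → ℝ → UnitAddTorus (Fin 3) → ℝ) (R : ℕ → ℝ → UnitAddTorus (Fin 3) → Fin 3 → EuclideanSpace ℝ (Fin 3)), 0 < ν₀ ∧ 0 < σ ∧ σ < 1 ∧ 0 < ε ∧ ∀ n, 0 < τ n ∧ Function.Periodic (U n) (τ n) ∧ Function.Periodic (R n) (τ n) ∧ (∀ t, Literature.Analysis.FunctionSpaces.Torus.HasZeroMean (U n t)) ∧ Literature.Analysis.FunctionSpaces.Torus.IsSmoothSpaceTimeOn Set.univ (R n) ∧ (∀ t x (i j : Fin 3), R n t x i j = R n t x j i) ∧ Literature.Analysis.FunctionSpaces.Torus.IsClassicalNSSolutionOn Set.univ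 (ν₀ * σ ^ n) (fun t x => f x + Literature.Analysis.FluidPDE.Torus.tensorDivergence (R n t) x) (U n) (P n) ∧ (∀ t x (i : Fin 3), ‖Literature.Analysis.FunctionSpaces.Torus.partialDeriv i (U n t) x‖ ≤ A / Real.sqrt (ν₀ * σ ^ n)) ∧ (∀ t x (j : Fin 3), ‖R n t x j‖ ≤ B * Real.sqrt (ν₀ * σ ^ n)) ∧ Literature.Analysis.FluidPDE.meanEnergy (U n) ≤ E ∧ ε ≤ Literature.Analysis.FluidPDE.longTimeAvgSup (fun t => MeasureTheory.integral MeasureTheory.volume (fun x => inner ℝ (f x) (U n t x)))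

/-- **Child 2 — `TowerClosing` (crux, ∀∃; the closing law over the class of child 1).** For every
force, ladder and K41 forced-NS-Reynolds subsolution tower as in `K41Tower` there are `N`, `D`, `θ > 0`
and, for every rung `n ≥ N`, an EXACT `τ'_n`-periodic classical solution `(u_n, p_n)` of NS_{ν_n} forced
by `f` alone that shadows the tower within one dissipation-range octave in mean energy,
`⟨‖u_n − U_n‖₂²⟩ ≤ D√ν_n`, and absorbs the fraction `θ` of the injected power, `⟨∫⟪f, u_n⟫⟩ ≥ θε`. -/
def TowerClosing : Prop :=
  ∀ f : UnitAddTorus (Fin 3) → EuclideanSpace ℝ (Fin 3), Literature.Analysis.FunctionSpaces.Torus.IsSmooth f → Literature.Analysis.FunctionSpaces.Torus.IsDivFree f → Literature.Analysis.FunctionSpaces.Torus.HasZeroMean f → ∀ (ν₀ σ A B E ε : ℝ) (τ : ℕ → ℝ) (U : ℕ → ℝ → UnitAddTorus (Fin 3) → EuclideanSpace ℝ (Fin 3)) (P : ℕ → ℝ → UnitAddTorus (Fin 3) → ℝ) (R : ℕ → ℝ → UnitAddTorus (Fin 3) → Fin 3 → EuclideanSpace ℝ (Fin 3)), 0 < ν₀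 → 0 < σ → σ < 1 → 0 < ε → (∀ n, 0 < τ n ∧ Function.Periodic (U n) (τ n) ∧ Function.Periodic (R n) (τ n) ∧ (∀ t, Literature.Analysis.FunctionSpaces.Torus.HasZeroMean (U n t)) ∧ Literature.Analysis.FunctionSpaces.Torus.IsSmoothSpaceTimeOn Set.univ (R n) ∧ (∀ t x (i j : Fin 3), R n t x i j = R n t x j i) ∧ Literature.Analysis.FunctionSpaces.Torus.IsClassicalNSSolutionOn Set.univ (ν₀ * σ ^ n) (fun t x => f x + Literature.Analysis.FluidPDE.Torus.tensorDivergence (R n t) x) (U n) (P n) ∧ (∀ t x (i : Fin 3), ‖Literature.Analysis.FunctionSpaces.Torus.partialDeriv i (U n t) x‖ ≤ A / Real.sqrt (ν₀ * σ ^ n)) ∧ (∀ t x (j : Fin 3), ‖R n t x j‖ ≤ B * Real.sqrt (ν₀ * σ ^ n)) ∧ Literature.Analysis.FluidPDE.meanEnergy (U n) ≤ E ∧ ε ≤ Literature.Analysis.FluidPDE.longTimeAvgSup (fun t => MeasureTheory.integral MeasureTheory.volume (fun x => inner ℝ (f x) (U n t x)))) → ∃ (N : ℕ) (D θ : ℝ)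 (τ' : ℕ → ℝ) (u : ℕ → ℝ → UnitAddTorus (Fin 3) → EuclideanSpace ℝ (Fin 3)) (p : ℕ → ℝ → UnitAddTorus (Fin 3) → ℝ), 0 < θ ∧ ∀ n, N ≤ n → Literature.Analysis.FunctionSpaces.Torus.IsClassicalNSSolutionOn Set.univ (ν₀ * σ ^ n) (fun _ => f) (u n) (p n) ∧ 0 < τ' n ∧ Function.Periodic (u n) (τ' n) ∧ Literature.Analysis.FluidPDE.meanEnergy (u n - U n) ≤ D * Real.sqrt (ν₀ * σ ^ n) ∧ θ * ε ≤ Literature.Analysis.FluidPDE.longTimeAvgSup (fun t => MeasureTheory.integral MeasureTheory.volume (fun x => inner ℝ (f x) (u n t x)))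

/-! ## Analysis used by the assembly -/

section Analysis

variable {u v : ℝ → UnitAddTorus (Fin 3) → EuclideanSpace ℝ (Fin 3)}

/-- **Smooth time-periodic fields have bounded energy**: `t ↦ ∫‖u(t)‖²` is continuous
(`IsSmoothSpaceTimeOn.continuousOn_integral`) and periodic, hence bounded. -/
theorem exists_energy_le_of_periodic (hu : IsSmoothSpaceTimeOn univ u) {τ : ℝ}
    (hper : Periodic u τ) (hτ : 0 < τ) : ∃ C : ℝ, ∀ t, ∫ x, ‖u t x‖ ^ 2 ≤ C := by
  have hcont : Continuous (fun t => ∫ x, ‖u t x‖ ^ 2) :=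
    continuousOn_univ.1 (hu.normSq.continuousOn_integral convex_univ)
  have hperg : Periodic (fun t => ∫ x, ‖u t x‖ ^ 2) τ := fun t => by simp only [hper t]
  obtain ⟨C, hC⟩ := (isCompact_Icc.image hcont).bddAbove (s := (fun t => ∫ x, ‖u t x‖ ^ 2) '' Icc 0 τ)
  refine ⟨C, fun t => ?_⟩
  obtain ⟨y, hy, hty⟩ := hperg.exists_mem_Ico₀ hτ t
  rw [hty]
  exact hC (mem_image_of_mem _ (Ico_subset_Icc_self hy))

/-- Parallelogram bound, integrated: `∫‖a‖² ≤ 2∫‖b‖² + 2∫‖a − b‖²` for smooth fields on `T³`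
(`a = b + (a − b)`, triangle inequality, `(p + q)² ≤ 2p² + 2q²`). -/
theorem integral_norm_sq_le_two_mul {a b : UnitAddTorus (Fin 3) → EuclideanSpace ℝ (Fin 3)}
    (ha : IsSmooth a) (hb : IsSmooth b) :
    ∫ x, ‖a x‖ ^ 2 ≤ 2 * (∫ x, ‖b x‖ ^ 2) + 2 * (∫ x, ‖a x - b x‖ ^ 2) := by
  have hd : IsSmooth (fun x => a x - b x) := ha.sub hb
  have hint : Integrable (fun x => 2 * ‖b x‖ ^ 2 + 2 * ‖a x - b x‖ ^ 2) volume :=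
    (hb.norm_sq.integrable.const_mul 2).add (hd.norm_sq.integrable.const_mul 2)
  calc ∫ x, ‖a x‖ ^ 2 ≤ ∫ x, (2 * ‖b x‖ ^ 2 + 2 * ‖a x - b x‖ ^ 2) := by
        refine integral_mono_of_nonneg (Eventually.of_forall fun x => sq_nonneg _) hint
          (Eventually.of_forall fun x => ?_)
        have h1 : ‖a x‖ ≤ ‖b x‖ + ‖a x - b x‖ := by
          calc ‖a x‖ = ‖b x + (a x - b x)‖ := by rw [add_sub_cancel]
            _ ≤ ‖b x‖ + ‖a x - b x‖ := norm_add_le _ _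
        have h2 : 0 ≤ ‖a x‖ := norm_nonneg _
        show ‖a x‖ ^ 2 ≤ 2 * ‖b x‖ ^ 2 + 2 * ‖a x - b x‖ ^ 2
        nlinarith [sq_nonneg (‖b x‖ - ‖a x - b x‖), norm_nonneg (b x), norm_nonneg (a x - b x)]
    _ = 2 * (∫ x, ‖b x‖ ^ 2) + 2 * (∫ x, ‖a x - b x‖ ^ 2) := by
        rw [integral_add (hb.norm_sq.integrable.const_mul 2) (hd.norm_sq.integrable.const_mul 2),
          integral_const_mul, integral_const_mul]

/-- Parallelogram bound, integrated: `∫‖a − b‖² ≤ 2∫‖a‖² + 2∫‖b‖²` for smooth fields on `T³`. -/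
theorem integral_norm_sub_sq_le {a b : UnitAddTorus (Fin 3) → EuclideanSpace ℝ (Fin 3)}
    (ha : IsSmooth a) (hb : IsSmooth b) :
    ∫ x, ‖a x - b x‖ ^ 2 ≤ 2 * (∫ x, ‖a x‖ ^ 2) + 2 * (∫ x, ‖b x‖ ^ 2) := by
  have hint : Integrable (fun x => 2 * ‖a x‖ ^ 2 + 2 * ‖b x‖ ^ 2) volume :=
    (ha.norm_sq.integrable.const_mul 2).add (hb.norm_sq.integrable.const_mul 2)
  calc ∫ x, ‖a x - b x‖ ^ 2 ≤ ∫ x, (2 * ‖a x‖ ^ 2 + 2 * ‖b x‖ ^ 2) := by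
        refine integral_mono_of_nonneg (Eventually.of_forall fun x => sq_nonneg _) hint
          (Eventually.of_forall fun x => ?_)
        have h1 : ‖a x - b x‖ ≤ ‖a x‖ + ‖b x‖ := norm_sub_le _ _
        have h2 : 0 ≤ ‖a x - b x‖ := norm_nonneg _
        show ‖a x - b x‖ ^ 2 ≤ 2 * ‖a x‖ ^ 2 + 2 * ‖b x‖ ^ 2
        nlinarith [sq_nonneg (‖a x‖ - ‖b x‖), norm_nonneg (a x), norm_nonneg (b x)]
    _ = 2 * (∫ x, ‖a x‖ ^ 2) + 2 * (∫ x, ‖b x‖ ^ 2) := by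
        rw [integral_add (ha.norm_sq.integrable.const_mul 2) (hb.norm_sq.integrable.const_mul 2),
          integral_const_mul, integral_const_mul]

/-- **Energy transfer through the shadowing distance** for the `limsup` long-time means of two
smooth time-periodic fields with possibly incommensurable periods:
`⟨‖u‖₂²⟩ ≤ 2⟨‖v‖₂²⟩ + 2⟨‖u − v‖₂²⟩`. Pointwise parallelogram bound `u = v + (u − v)`, then
monotonicity/subadditivity of `longTimeAvgSup` for nonnegative locally integrable observables with
bounded running means (`longTimeAvgSup_le_add_of_le_add`); the running means are bounded because the
energies of `u`, `v` are (`exists_energy_le_of_periodic`). -/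
theorem meanEnergy_le_two_mul_add (hu : IsSmoothSpaceTimeOn univ u) (hv : IsSmoothSpaceTimeOn univ v)
    {τu τv : ℝ} (hpu : Periodic u τu) (hτu : 0 < τu) (hpv : Periodic v τv) (hτv : 0 < τv) :
    meanEnergy u ≤ 2 * meanEnergy v + 2 * meanEnergy (u - v) := by
  obtain ⟨Mu, hMu⟩ := exists_energy_le_of_periodic hu hpu hτu
  obtain ⟨Mv, hMv⟩ := exists_energy_le_of_periodic hv hpv hτv
  have hus : ∀ t, IsSmooth (u t) := fun t => hu.isSmooth_slice (mem_univ t)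
  have hvs : ∀ t, IsSmooth (v t) := fun t => hv.isSmooth_slice (mem_univ t)
  have heu0 : ∀ t, 0 ≤ ∫ x, ‖u t x‖ ^ 2 := fun t => integral_nonneg fun x => sq_nonneg _
  have hev0 : ∀ t, 0 ≤ ∫ x, ‖v t x‖ ^ 2 := fun t => integral_nonneg fun x => sq_nonneg _
  have hed0 : ∀ t, 0 ≤ ∫ x, ‖u t x - v t x‖ ^ 2 := fun t => integral_nonneg fun x => sq_nonneg _
  -- pointwise-in-time parallelogram bounds
  have hle : ∀ t, ∫ x, ‖u t x‖ ^ 2 ≤ 2 * (∫ x, ‖v t x‖ ^ 2) + 2 * (∫ x, ‖u t x - v t x‖ ^ 2) :=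
    fun t => integral_norm_sq_le_two_mul (hus t) (hvs t)
  have hdle : ∀ t, ∫ x, ‖u t x - v t x‖ ^ 2 ≤ 2 * Mu + 2 * Mv := fun t => by
    have h := integral_norm_sub_sq_le (hus t) (hvs t)
    linarith [hMu t, hMv t]
  -- continuity in time of the observables (local integrability)
  have hcv : Continuous (fun t => ∫ x, ‖v t x‖ ^ 2) :=
    continuousOn_univ.1 (hv.normSq.continuousOn_integral convex_univ)
  have hcd : Continuous (fun t => ∫ x, ‖u t x - v t x‖ ^ 2) :=
    continuousOn_univ.1 ((hu.sub hv).normSq.continuousOn_integral convex_univ)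
  have hfi : ∀ T, 0 < T → IntegrableOn (fun t => 2 * ∫ x, ‖v t x‖ ^ 2) (Ioc 0 T) := fun T _ =>
    ((hcv.const_mul 2).integrableOn_Icc).mono_set Ioc_subset_Icc_self
  have hgi : ∀ T, 0 < T → IntegrableOn (fun t => 2 * ∫ x, ‖u t x - v t x‖ ^ 2) (Ioc 0 T) :=
    fun T _ => ((hcd.const_mul 2).integrableOn_Icc).mono_set Ioc_subset_Icc_self
  -- bounded running means
  have hfb : IsBoundedUnder (· ≤ ·) atTop (timeMean fun t => 2 * ∫ x, ‖v t x‖ ^ 2) :=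
    isBoundedUnder_le_timeMean (C := 2 * Mv) fun t _ => by
      rw [abs_of_nonneg (by linarith [hev0 t])]; linarith [hMv t]
  have hgb : IsBoundedUnder (· ≤ ·) atTop (timeMean fun t => 2 * ∫ x, ‖u t x - v t x‖ ^ 2) :=
    isBoundedUnder_le_timeMean (C := 2 * (2 * Mu + 2 * Mv)) fun t _ => by
      rw [abs_of_nonneg (by linarith [hed0 t])]; linarith [hdle t]
  have hmain := longTimeAvgSup_le_add_of_le_add (u := fun t => ∫ x, ‖u t x‖ ^ 2)
    (f := fun t => 2 * ∫ x, ‖v t x‖ ^ 2) (g := fun t => 2 * ∫ x, ‖u t x - v t x‖ ^ 2)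
    heu0 (fun t => by linarith [hev0 t]) (fun t => by linarith [hed0 t]) hfi hgi hfb hgb
    (fun t _ => hle t)
  rw [longTimeAvgSup_const_mul (by norm_num : (0 : ℝ) ≤ 2),
    longTimeAvgSup_const_mul (by norm_num : (0 : ℝ) ≤ 2)] at hmain
  rw [meanEnergy_eq_longTimeAvgSup, meanEnergy_eq_longTimeAvgSup, meanEnergy_eq_longTimeAvgSup]
  simpa only [Pi.sub_apply] using hmain

/-- **Period-averaged energy identity**: for a time-periodic classical solution of Navier–Stokes on
`ℝ × T³` with a smooth steady force, the mean dissipation is the mean injected power,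
`⟨ν‖∇u‖₂²⟩ = ⟨∫⟪f, u⟫⟩` (energy equality of classical solutions, Robinson–Rodrigo–Sadowski 2016 Thm.
6.5 / Doering–Foias 2002 §2, through `meanDissipation_eq_longTimeAvgSup_inner`; the forward energy
bound holds because a smooth periodic field has bounded energy). -/
theorem meanDissipation_eq_power_of_periodic {ν : ℝ} {f : UnitAddTorus (Fin 3) → EuclideanSpace ℝ (Fin 3)}
    (hf : IsSmooth f) {p : ℝ → UnitAddTorus (Fin 3) → ℝ}
    (h : IsClassicalNSSolutionOn univ ν (fun _ => f) u p) {τ : ℝ} (hper : Periodic u τ) (hτ : 0 < τ) :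
    meanDissipation ν u = longTimeAvgSup (fun t => ∫ x, ⟪f x, u t x⟫_ℝ) := by
  obtain ⟨C, hC⟩ := exists_energy_le_of_periodic h.smooth_velocity hper hτ
  exact _root_.Summit.AnomalousDissipation.AnomalousDissipation.Theorems.ChainRealisation.SeparatrixFluxPinning.meanDissipation_eq_longTimeAvgSup_inner
    (h.mono (subset_univ _) (uniqueDiffOn_Ici 0)) hf (fun t _ => hC t)

end Analysis

/-! ## The assembly -/

/-- **ASSEMBLY of the tower split** (FRAME FORM: the two children and the crux body INLINED VERBATIM, so that
this module does not import the route module and the gate may render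
`theorem BoussinesqLadderGlueBy_holds : K41Tower → TowerClosing → BoussinesqLadder := <this decl>` inside
`Theses/BoussinesqOctaves.lean`, the link typechecking by δ-unfolding; the by-name form is `boussinesqLadder_of_pieces'`
below and, against the route decl itself, `Cruxes/BoussinesqLadder/SeamByName.lean`):
`K41Tower → TowerClosing → BoussinesqLadder`.
Take the tower of child 1; child 2 gives `N, D, θ` and exact periodic shadows `u_n` for `n ≥ N`.
The Boussinesq ladder is the re-based geometric ladder `ν₀' = ν₀σᴺ` (`ν₀'σⁿ = ν₀σ^{N+n}`) with the
states `u_{N+n}`: their mean energies are `≤ 2E + 2|D|√ν₀` by the energy transfer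
`⟨‖u‖²⟩ ≤ 2⟨‖U‖²⟩ + 2⟨‖u − U‖²⟩` (tower energy bound + shadowing distance `D√ν_n ≤ |D|√ν₀`), and their
mean dissipations are `≥ θε > 0` because, for time-periodic classical solutions with a steady force,
mean dissipation equals mean injected power (`meanDissipation_eq_power_of_periodic`). -/
theorem boussinesqLadder_of_pieces
    (h₁ : ∃ f : UnitAddTorus (Fin 3) → EuclideanSpace ℝ (Fin 3), Literature.Analysis.FunctionSpaces.Torus.IsSmooth f ∧ Literature.Analysis.FunctionSpaces.Torus.IsDivFree f ∧ Literature.Analysis.FunctionSpaces.Torus.HasZeroMean f ∧ ∃ (ν₀ σ A B E ε : ℝ) (τ : ℕ → ℝ) (U : ℕ → ℝ → UnitAddTorus (Fin 3) → EuclideanSpace ℝ (Fin 3)) (P : ℕ → ℝ → UnitAddTorus (Fin 3) → ℝ) (R : ℕ → ℝ → UnitAddTorus (Fin 3) → Fin 3 → EuclideanSpace ℝ (Fin 3)), 0 < ν₀ ∧ 0 < σ ∧ σ < 1 ∧ 0 < ε ∧ ∀ n, 0 < τ n ∧ Function.Periodic (U n) (τ n) ∧ Function.Periodic (R n) (τ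 n) ∧ (∀ t, Literature.Analysis.FunctionSpaces.Torus.HasZeroMean (U n t)) ∧ Literature.Analysis.FunctionSpaces.Torus.IsSmoothSpaceTimeOn Set.univ (R n) ∧ (∀ t x (i j : Fin 3), R n t x i j = R n t x j i) ∧ Literature.Analysis.FunctionSpaces.Torus.IsClassicalNSSolutionOn Set.univ (ν₀ * σ ^ n) (fun t x => f x + Literature.Analysis.FluidPDE.Torus.tensorDivergence (R n t) x) (U n) (P n) ∧ (∀ t x (i : Fin 3), ‖Literature.Analysis.FunctionSpaces.Torus.partialDeriv i (U n t) x‖ ≤ A / Real.sqrt (ν₀ * σ ^ n)) ∧ (∀ t x (j : Fin 3), ‖R n t x j‖ ≤ B * Real.sqrt (ν₀ * σ ^ n)) ∧ Literature.Analysis.FluidPDE.meanEnergy (U n) ≤ E ∧ ε ≤ Literature.Analysis.FluidPDE.longTimeAvgSup (fun t => MeasureTheory.integral MeasureTheory.volume (fun x => inner ℝ (f x) (U n t x))))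
    (h₂ : ∀ f : UnitAddTorus (Fin 3) → EuclideanSpace ℝ (Fin 3), Literature.Analysis.FunctionSpaces.Torus.IsSmooth f → Literature.Analysis.FunctionSpaces.Torus.IsDivFree f → Literature.Analysis.FunctionSpaces.Torus.HasZeroMean f → ∀ (ν₀ σ A B E ε : ℝ) (τ : ℕ → ℝ) (U : ℕ → ℝ → UnitAddTorus (Fin 3) → EuclideanSpace ℝ (Fin 3)) (P : ℕ → ℝ → UnitAddTorus (Fin 3) → ℝ) (R : ℕ → ℝ → UnitAddTorus (Fin 3) → Fin 3 → EuclideanSpace ℝ (Fin 3)), 0 < ν₀ → 0 < σ → σ < 1 → 0 < ε → (∀ n, 0 < τ n ∧ Function.Periodic (U n) (τ n) ∧ Function.Periodic (R n) (τ n) ∧ (∀ t, Literature.Analysis.FunctionSpaces.Torus.HasZeroMean (U n t)) ∧ Literature.Analysis.FunctionSpaces.Torus.IsSmoothSpaceTimeOn Set.univ (R n) ∧ (∀ t x (i j : Fin 3), R n t x i j = R n t x j i) ∧ Literature.Analysis.FunctionSpaces.Torus.IsClassicalNSSolutionOn Set.univ (ν₀ * σ ^ n) (fun t x => f x + Literature.Analysis.FluidPDE.Torus.tensorDivergence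 (R n t) x) (U n) (P n) ∧ (∀ t x (i : Fin 3), ‖Literature.Analysis.FunctionSpaces.Torus.partialDeriv i (U n t) x‖ ≤ A / Real.sqrt (ν₀ * σ ^ n)) ∧ (∀ t x (j : Fin 3), ‖R n t x j‖ ≤ B * Real.sqrt (ν₀ * σ ^ n)) ∧ Literature.Analysis.FluidPDE.meanEnergy (U n) ≤ E ∧ ε ≤ Literature.Analysis.FluidPDE.longTimeAvgSup (fun t => MeasureTheory.integral MeasureTheory.volume (fun x => inner ℝ (f x) (U n t x)))) → ∃ (N : ℕ) (D θ : ℝ) (τ' : ℕ → ℝ) (u : ℕ → ℝ → UnitAddTorus (Fin 3) → EuclideanSpace ℝ (Fin 3)) (p : ℕ → ℝ → UnitAddTorus (Fin 3) → ℝ), 0 < θ ∧ ∀ n, N ≤ n → Literature.Analysis.FunctionSpaces.Torus.IsClassicalNSSolutionOn Set.univ (ν₀ * σ ^ n) (fun _ => f) (u n) (p n) ∧ 0 < τ' n ∧ Function.Periodic (u n) (τ' n) ∧ Literature.Analysis.FluidPDE.meanEnergy (u n - U n) ≤ D * Real.sqrt (ν₀ * σ ^ n) ∧ θ * ε ≤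 Literature.Analysis.FluidPDE.longTimeAvgSup (fun t => MeasureTheory.integral MeasureTheory.volume (fun x => inner ℝ (f x) (u n t x)))) :
    ∃ f : UnitAddTorus (Fin 3) → EuclideanSpace ℝ (Fin 3), Literature.Analysis.FunctionSpaces.Torus.IsSmooth f ∧ Literature.Analysis.FunctionSpaces.Torus.IsDivFree f ∧ Literature.Analysis.FunctionSpaces.Torus.HasZeroMean f ∧ ∃ (ν₀ σ : ℝ) (τ : ℕ → ℝ) (u : ℕ → ℝ → UnitAddTorus (Fin 3) → EuclideanSpace ℝ (Fin 3)) (p : ℕ → ℝ → UnitAddTorus (Fin 3) → ℝ), 0 < ν₀ ∧ 0 < σ ∧ σ < 1 ∧ (∀ n, Literature.Analysis.FunctionSpaces.Torus.IsClassicalNSSolutionOn Set.univ (ν₀ * σ ^ n) (fun _ => f) (u n) (p n) ∧ 0 < τ n ∧ Function.Periodic (u n) (τ n)) ∧ (∃ E : ℝ, ∀ n, Literature.Analysis.FluidPDE.meanEnergy (u n) ≤ E) ∧ ∃ ε : ℝ, 0 < ε ∧ ∀ n, ε ≤ Literature.Analysis.FluidPDE.meanDissipation (ν₀ * σ ^ n)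 (u n) := by
  obtain ⟨f, hf, hdiv, hmean, ν₀, σ, A, B, E, ε, τ, U, P, R, hν₀, hσ0, hσ1, hε, hT⟩ := h₁
  obtain ⟨N, D, θ, τ', u, p, hθ, hclose⟩ :=
    h₂ f hf hdiv hmean ν₀ σ A B E ε τ U P R hν₀ hσ0 hσ1 hε hT
  -- re-base the geometric ladder at rung `N`
  have hν : ∀ n : ℕ, ν₀ * σ ^ N * σ ^ n = ν₀ * σ ^ (N + n) := fun n => by
    rw [pow_add, mul_assoc]
  have hνle : ∀ m : ℕ, Real.sqrt (ν₀ * σ ^ m) ≤ Real.sqrt ν₀ := fun m =>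
    Real.sqrt_le_sqrt (mul_le_of_le_one_right hν₀.le (pow_le_one₀ hσ0.le hσ1.le))
  refine ⟨f, hf, hdiv, hmean, ν₀ * σ ^ N, σ, fun n => τ' (N + n), fun n => u (N + n),
    fun n => p (N + n), mul_pos hν₀ (pow_pos hσ0 N), hσ0, hσ1, fun n => ?_,
    ⟨2 * E + 2 * (|D| * Real.sqrt ν₀), fun n => ?_⟩, ⟨θ * ε, mul_pos hθ hε, fun n => ?_⟩⟩
  · -- exact periodic classical solutions on every rung of the re-based ladder
    obtain ⟨hsol, hτn, hper, -, -⟩ := hclose (N + n) (Nat.le_add_right N n)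
    exact ⟨by rw [hν n]; exact hsol, hτn, hper⟩
  · -- ν-uniform energy bound, transferred from the tower through the shadowing distance
    obtain ⟨hsol, hτn, hper, hshadow, -⟩ := hclose (N + n) (Nat.le_add_right N n)
    obtain ⟨hτU, hperU, -, -, -, -, hsolU, -, -, hEU, -⟩ := hT (N + n)
    have htrans := meanEnergy_le_two_mul_add hsol.smooth_velocity hsolU.smooth_velocity
      hper hτn hperU hτU
    have hD : D * Real.sqrt (ν₀ * σ ^ (N + n)) ≤ |D| * Real.sqrt ν₀ :=
      (mul_le_mul_of_nonneg_right (le_abs_self D) (Real.sqrt_nonneg _)).trans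
        (mul_le_mul_of_nonneg_left (hνle (N + n)) (abs_nonneg D))
    linarith
  · -- dissipation floor = power floor, by the period-averaged energy identity
    obtain ⟨hsol, hτn, hper, -, hpow⟩ := hclose (N + n) (Nat.le_add_right N n)
    rw [hν n, meanDissipation_eq_power_of_periodic hf hsol hper hτn]
    exact hpow


/-- The assembly stated with this module's names for the pieces (δ-equal to `boussinesqLadder_of_pieces`);
conclusion = the body of `BoussinesqOctaves.BoussinesqLadder` verbatim. -/
theorem boussinesqLadder_of_pieces' (h₁ : K41Tower) (h₂ : TowerClosing) :
    ∃ f : UnitAddTorus (Fin 3) → EuclideanSpace ℝ (Fin 3), Literature.Analysis.FunctionSpaces.Torus.IsSmooth f ∧ Literature.Analysis.FunctionSpaces.Torus.IsDivFree f ∧ Literature.Analysis.FunctionSpaces.Torus.HasZeroMean f ∧ ∃ (ν₀ σ : ℝ) (τ : ℕ → ℝ) (u : ℕ → ℝ → UnitAddTorus (Fin 3) → EuclideanSpace ℝ (Fin 3)) (p : ℕ → ℝ → UnitAddTorus (Fin 3) → ℝ), 0 < ν₀ ∧ 0 < σ ∧ σ < 1 ∧ (∀ n, Literature.Analysis.FunctionSpaces.Torus.IsClassicalNSSolutionOn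 Set.univ (ν₀ * σ ^ n) (fun _ => f) (u n) (p n) ∧ 0 < τ n ∧ Function.Periodic (u n) (τ n)) ∧ (∃ E : ℝ, ∀ n, Literature.Analysis.FluidPDE.meanEnergy (u n) ≤ E) ∧ ∃ ε : ℝ, 0 < ε ∧ ∀ n, ε ≤ Literature.Analysis.FluidPDE.meanDissipation (ν₀ * σ ^ n) (u n) :=
  boussinesqLadder_of_pieces h₁ h₂

end Summit.AnomalousDissipation.AnomalousDissipation.Cruxes.BoussinesqLadder.TowerSplit

end
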